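import Summits.QuantumFields.YangMills.Theorems.BalabanUVNodesN16Eq42LipschitzSmallField
import Literature.MathematicalPhysics.QuantumFieldTheory.Balaban1983to89.B7Prop2SpecialUnitary
import HarnessLib

/-!
# YM-DAG node N16 (NE3), the located averaging pin (42) ↔ (0.4) — part 36: INPUT (D) OF PART 35 DISCHARGED — on `SU(N)`-valued small fields the coarse plaquettes of BOTH
# one-step averages have DETERMINANT ONE (the (0.4) of record by construction; (42) by [Balaban1985Averaging] Prop. 2's `SU(N)` closure, lit-balaban's `B7Prop2SpecialUnitary`)

Cell `pub-ymgap`, width seat `pub-ymgap-dag-n16-w3` (director-ym №197 ∕ HUMAN RULING D-0149), generation 9; part 36 of the W1b lineage (part 35 `…N16TraceThirdOrderOfDetEq`: equal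
determinants (D) + second-order close logarithms (S) ⇒ coarse plaquette traces agree one order better — the mechanism of part 34's one-step action discrepancy `D`).
`--kind proof --supports stmt-QuantumFields-27366 --as helper` (K3⁸, KEY MAP v2; count-neutral; 0 `def`).  `bears_on: R4∕N16`.

THE POINT.  Part 35's hypothesis (D) «the coarse plaquettes of the (42)- and of the (0.4)-average of the same small field have EQUAL DETERMINANTS» is FREE on N16's objects: both
one-step outputs are `SU(N)`-valued, so every holonomy — in particular every plaquette variable — has determinant ONE.
 * §1 `mem_range_ιSU_iff` — this lineage's gauge group `(Node00.ιSU N).range` (parts 32∕33) IS lit-balaban's `B7Prop2SpecialUnitary.specialUnitaryUnits (Fin N)` (same carrier: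
   `↑u ∈ SU(N)`); `det_coe_eq_one_of_mem` ∕ `det_hol_eq_one` ∕ `det_fhol_eq_one` ∕ `det_cplaq_eq_one` — holonomies of an `SU(N)`-valued configuration have determinant `1`
   (`B7Prop2Explicit.hol_mem_of`).
 * §2 ★ `step04_mem_specialUnitaryUnits` — THE (0.4) STEP OF RECORD IS `SU(N)`-VALUED FOR EVERY INPUT (g0's `step04 = lift ∘ avOfRecord.avg ∘ descendSU`: a lift of a torus `SU(N)`
   field; `step04_mem_ne3DomOfRecord₁₁`, `Node00.coe_mem_specialUnitaryGroup_of_mem_ne3DomOfRecord₁₁`); `det_fhol_step04_eq_one`.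
 * §3 ★ `step42_mem_specialUnitaryUnits_of_smallField` — (42) KEEPS `SU(N)` ON SMALL FIELDS: `U` `SU(N)`-valued with `SmallField U α`, `0 ≤ α`, `512(d+1)(d+4)L²α ≤ 1` and the
   RANK-DEPENDENT smallness `card n · (16(d+1)(d+4)L²α) < π` ⇒ `step42 L U` is `SU(N)`-valued ([Balaban1985Averaging] p. 25's guard `|V(Γ_{c,x})V(c)⁻¹ − 1| ≤ 16(d+1)(d+4)L²α`,
   lit-balaban's `B7Prop2Explicit.norm_Wcx_sub_one_le`, and the `SU(N)` closure of (42) at that radius, `B7Prop2SpecialUnitary.bavg_mem_specialUnitaryUnits`: `tr log W = log det W = 0`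
   needs `card·‖log W‖ < π`); `det_fhol_step42_eq_one`.
 * §4 ★★ `det_fhol_step42_eq_det_fhol_step04` — INPUT (D) OF PART 35 AT N16's OBJECTS (`d = 4`, `𝔸 = M_N(ℂ)`): for `U` `SU(N)`-valued small-field as in §3, at EVERY plaquette `p`,
   `det (fhol (step42 F.L U) p) = det (fhol (step04 F N t U) p)` (`= 1`); `det_cplaq_step42_eq_det_cplaq_step04` (the coarse-plaquette form part 35 §3 consumes).
READING (honest).  With part 36 the per-plaquette reduction of part 35 has ONE displayed input left: (S), the second-order closeness (up to a unitary conjugation) of the LOGARITHMS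
of the coarse plaquettes of the two one-step outputs — parts 22∕25∕26 in BCH currency.  The rank-dependent smallness of §3 is print's standing regime for `G = SU(N)` (lit-balaban
`B7Prop2SpecialUnitary`, radius `∝ 1∕N`), not an artefact.

HONEST FRAMING.  [folklore] bookkeeping BY NAME over lit-balaban's `B7Prop2SpecialUnitary` ∕ `B7Prop2Explicit` and g0's `step04`; 0 `def`, 0 `sorry`, no `instance`, no `notation`; NO
estimate beyond the cited kernel theorems; nothing of [Balaban1985Averaging] ∕ [Balaban1987RG1] asserted; K3⁸ stubs `stub_rates13HV` ∕ `stub_expansion13HV` NOT touched; N16 ∕ NE3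
NOT discharged; count-neutral (typed 28∕28 · discharged 5∕27 work-bound, A 5∕28 — unmoved).  One finite four-torus programme at fixed `ε` — the Yang–Mills mass gap (Clay) is NOT
proved by any of this; R4 closes the conditional finite-𝕋⁴ rung `BalabanLadder.UV` only; nothing continuum ∕ ℝ⁴ ∕ OS.
-/

set_option autoImplicit false

open scoped BigOperators Matrix Matrix.Norms.L2Operator
open NormedSpace

namespace Summit.QuantumFields.YangMills.BalabanUVNodes.N16CoarsePlaquetteDetOne

open Literature.MathematicalPhysics.QuantumFieldTheory.Balaban1983to89
open Literature.MathematicalPhysics.QuantumFieldTheory.Balaban1983to89.T4Continuum (T4Family)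
open B7Prop1Explicit B7Prop2Explicit
open B7Prop2SpecialUnitary (specialUnitaryUnits mem_specialUnitaryUnits specialUnitaryUnits_le_unitaryUnits bavg_mem_specialUnitaryUnits)
open T4AveragingDeficitWall (IsUnitaryCfg SmallField fhol)
open Summit.QuantumFields.BalabanUV.T4Continuum
open AveragingDeficitTransport (mem_U1_of_unitary)
open Node00 (MatA SU ιSU coe_ιSU ne3NperOfRecord₁₁ ne3DomOfRecord₁₁)
open Summit.QuantumFields.YangMills.BalabanUVNodes.N16AveragingPin (step42 step04 step04_mem_ne3DomOfRecord₁₁)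

noncomputable section

/-! ## §1 The gauge group of parts 32∕33 is lit-balaban's `specialUnitaryUnits`; holonomies of `SU(N)` fields have determinant one -/

section SU

variable {d : ℕ} {n : Type*} [Fintype n] [DecidableEq n]

/-- A unit in `specialUnitaryUnits` has determinant `1`. [folklore] -/
theorem det_coe_eq_one_of_mem {u : (Matrix n n ℂ)ˣ} (hu : u ∈ specialUnitaryUnits n) : (u : Matrix n n ℂ).det = 1 :=
  (Matrix.mem_specialUnitaryGroup_iff.1 (mem_specialUnitaryUnits.1 hu)).2

/-- Holonomies of an `SU(N)`-valued configuration are `SU(N)`-valued (lit-balaban's `hol_mem_of`), hence have determinant `1`. [folklore] -/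
theorem det_hol_eq_one {B : Site d → Fin d → (Matrix n n ℂ)ˣ} (hB : ∀ x κ, B x κ ∈ specialUnitaryUnits n) (x : Site d) (w : List (Letter d)) :
    ((hol B x w : (Matrix n n ℂ)ˣ) : Matrix n n ℂ).det = 1 :=
  det_coe_eq_one_of_mem (hol_mem_of hB x w)

/-- … in particular the fine plaquette variables. [folklore] -/
theorem det_fhol_eq_one {B : Site d → Fin d → (Matrix n n ℂ)ˣ} (hB : ∀ x κ, B x κ ∈ specialUnitaryUnits n) (p : T4AveragingDeficitWall.Plaq d) :
    ((fhol B p : (Matrix n n ℂ)ˣ) : Matrix n n ℂ).det = 1 :=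
  det_hol_eq_one hB _ _

/-- … and the coarse plaquette variables of side `L`. [folklore] -/
theorem det_cplaq_eq_one {B : Site d → Fin d → (Matrix n n ℂ)ˣ} (hB : ∀ x κ, B x κ ∈ specialUnitaryUnits n) (L : ℕ) (z : Site d) (μ ν : Fin d) :
    ((cplaq L B z μ ν : (Matrix n n ℂ)ˣ) : Matrix n n ℂ).det = 1 := by
  have hmem : cplaq L B z μ ν ∈ specialUnitaryUnits n := by
    unfold cplaq
    exact (specialUnitaryUnits n).mul_mem ((specialUnitaryUnits n).mul_mem ((specialUnitaryUnits n).mul_mem (hB _ _) (hB _ _))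
      ((specialUnitaryUnits n).inv_mem (hB _ _))) ((specialUnitaryUnits n).inv_mem (hB _ _))
  exact det_coe_eq_one_of_mem hmem

variable (N : ℕ)

/-- **THIS LINEAGE's `Γ_SU = (ιSU N).range` IS lit-balaban's `specialUnitaryUnits (Fin N)`** (same carrier `↑u ∈ SU(N)`). [folklore] -/
theorem mem_range_ιSU_iff {u : (MatA N)ˣ} : u ∈ (ιSU N).range ↔ u ∈ specialUnitaryUnits (Fin N) := by
  rw [mem_specialUnitaryUnits]
  constructor
  · rintro ⟨g, rfl⟩
    rw [coe_ιSU]; exact g.2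
  · intro hu
    exact ⟨⟨(u : MatA N), hu⟩, Units.ext (coe_ιSU N _)⟩

end SU

/-! ## §2 The (0.4) step of record is `SU(N)`-valued for every input -/

section Step04

variable (F : T4Family) (N : ℕ) [NeZero N]

/-- **★ THE (0.4) STEP OF RECORD IS `SU(N)`-VALUED** (every depth index `t`, every input: it is the lift of a torus `SU(N)` field). [folklore] -/
theorem step04_mem_specialUnitaryUnits (t : ℕ) (U : (Fin 4 → ℤ) → Fin 4 → (MatA N)ˣ) (x : Fin 4 → ℤ) (i : Fin 4) :
    step04 F N t U x i ∈ specialUnitaryUnits (Fin N) :=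
  mem_specialUnitaryUnits.2 (Node00.coe_mem_specialUnitaryGroup_of_mem_ne3DomOfRecord₁₁ (step04_mem_ne3DomOfRecord₁₁ F N t U) x i)

/-- Hence every plaquette variable of the (0.4) output has determinant `1`. [folklore] -/
theorem det_fhol_step04_eq_one (t : ℕ) (U : (Fin 4 → ℤ) → Fin 4 → (MatA N)ˣ) (p : T4AveragingDeficitWall.Plaq 4) :
    ((fhol (step04 F N t U) p : (MatA N)ˣ) : MatA N).det = 1 :=
  det_fhol_eq_one (step04_mem_specialUnitaryUnits F N t U) p

/-- … and every coarse plaquette variable. [folklore] -/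
theorem det_cplaq_step04_eq_one (t L : ℕ) (U : (Fin 4 → ℤ) → Fin 4 → (MatA N)ˣ) (z : Fin 4 → ℤ) (μ ν : Fin 4) :
    ((cplaq L (step04 F N t U) z μ ν : (MatA N)ˣ) : MatA N).det = 1 :=
  det_cplaq_eq_one (step04_mem_specialUnitaryUnits F N t U) L z μ ν

end Step04

/-! ## §3 (42) keeps `SU(N)` on small fields (rank-dependent radius) -/

section Step42

variable {d : ℕ} {n : Type*} [Fintype n] [DecidableEq n] [Nonempty n]

/-- **★ (42) KEEPS `SU(N)` ON SMALL FIELDS**: `U` `SU(N)`-valued, `SmallField U α` with `0 ≤ α`, `512(d+1)(d+4)L²α ≤ 1` and `card n · (16(d+1)(d+4)L²α) < π` ⇒ every bond variable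
of `step42 L U = rescale L (bavg L U)` is in `SU(N)` ([Balaban1985Averaging] p. 25's guard via lit-balaban's `norm_Wcx_sub_one_le`, then `bavg_mem_specialUnitaryUnits`, then
`rescale_mem_of`). [folklore] -/
theorem step42_mem_specialUnitaryUnits_of_smallField {L : ℕ} (hL : 1 ≤ L) {U : Site d → Fin d → (Matrix n n ℂ)ˣ} (hU : ∀ x κ, U x κ ∈ specialUnitaryUnits n)
    {α : ℝ} (hα : 0 ≤ α) (hsmall : 512 * (d + 1) * (d + 4) * (L : ℝ) ^ 2 * α ≤ 1)
    (hrank : Fintype.card n * (16 * ((d : ℝ) + 1) * (d + 4) * (L : ℝ) ^ 2 * α) < Real.pi) (hsf : SmallField U α) (x : Site d) (κ : Fin d) :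
    step42 L U x κ ∈ specialUnitaryUnits n := by
  have hU1 : ∀ x κ, U x κ ∈ U1 (Matrix n n ℂ) := fun x κ => mem_U1_of_unitary (specialUnitaryUnits_le_unitaryUnits (hU x κ))
  have hbavg : ∀ (q : Site d) (κ : Fin d), bavg L U q κ ∈ specialUnitaryUnits n := by
    intro q κ
    refine bavg_mem_specialUnitaryUnits hU L q κ (t := 16 * ((d : ℝ) + 1) * (d + 4) * (L : ℝ) ^ 2 * α) ?_ hrank ?_
    · nlinarith [hsmall, hα, sq_nonneg (L : ℝ), (by positivity : (0 : ℝ) ≤ (d : ℝ))]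
    · intro r
      have h := norm_Wcx_sub_one_le L hL U hU1 hα hsmall (fun x κ κ' hκ => hsf x κ κ' hκ) q κ r
      linarith
  show rescale L (bavg L U) x κ ∈ specialUnitaryUnits n
  exact rescale_mem_of hbavg L x κ

/-- Hence every plaquette variable of the (42) output has determinant `1`. [folklore] -/
theorem det_fhol_step42_eq_one {L : ℕ} (hL : 1 ≤ L) {U : Site d → Fin d → (Matrix n n ℂ)ˣ} (hU : ∀ x κ, U x κ ∈ specialUnitaryUnits n)
    {α : ℝ} (hα : 0 ≤ α) (hsmall : 512 * (d + 1) * (d + 4) * (L : ℝ) ^ 2 * α ≤ 1)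
    (hrank : Fintype.card n * (16 * ((d : ℝ) + 1) * (d + 4) * (L : ℝ) ^ 2 * α) < Real.pi) (hsf : SmallField U α) (p : T4AveragingDeficitWall.Plaq d) :
    ((fhol (step42 L U) p : (Matrix n n ℂ)ˣ) : Matrix n n ℂ).det = 1 :=
  det_fhol_eq_one (step42_mem_specialUnitaryUnits_of_smallField hL hU hα hsmall hrank hsf) p

/-- … and every coarse plaquette variable. [folklore] -/
theorem det_cplaq_step42_eq_one {L : ℕ} (hL : 1 ≤ L) {U : Site d → Fin d → (Matrix n n ℂ)ˣ} (hU : ∀ x κ, U x κ ∈ specialUnitaryUnits n)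
    {α : ℝ} (hα : 0 ≤ α) (hsmall : 512 * (d + 1) * (d + 4) * (L : ℝ) ^ 2 * α ≤ 1)
    (hrank : Fintype.card n * (16 * ((d : ℝ) + 1) * (d + 4) * (L : ℝ) ^ 2 * α) < Real.pi) (hsf : SmallField U α) (M : ℕ) (z : Site d) (μ ν : Fin d) :
    ((cplaq M (step42 L U) z μ ν : (Matrix n n ℂ)ˣ) : Matrix n n ℂ).det = 1 :=
  det_cplaq_eq_one (step42_mem_specialUnitaryUnits_of_smallField hL hU hα hsmall hrank hsf) M z μ ν

end Step42

/-! ## §4 Input (D) of part 35 at N16's objects: the two one-step outputs have plaquettes of equal (unit) determinant -/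

section Record

variable (F : T4Family) (N : ℕ) [NeZero N]

/-- **★★ INPUT (D) OF PART 35, DISCHARGED** (`d = 4`, `𝔸 = M_N(ℂ)`): for `U` `SU(N)`-valued with `SmallField U α`, `0 ≤ α`, `512·5·8·L²α ≤ 1`, `N·(16·5·8·L²α) < π`, at every
fine plaquette `p` of the coarse unit lattice: `det (fhol (step42 F.L U) p) = det (fhol (step04 F N t U) p)` (both `= 1`). [folklore] -/
theorem det_fhol_step42_eq_det_fhol_step04 (t : ℕ) {U : (Fin 4 → ℤ) → Fin 4 → (MatA N)ˣ} (hU : ∀ x κ, U x κ ∈ specialUnitaryUnits (Fin N))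
    {α : ℝ} (hα : 0 ≤ α) (hsmall : 512 * (4 + 1) * (4 + 4) * (F.L : ℝ) ^ 2 * α ≤ 1)
    (hrank : Fintype.card (Fin N) * (16 * ((4 : ℝ) + 1) * (4 + 4) * (F.L : ℝ) ^ 2 * α) < Real.pi) (hsf : SmallField U α) (p : T4AveragingDeficitWall.Plaq 4) :
    ((fhol (step42 F.L U) p : (MatA N)ˣ) : MatA N).det = ((fhol (step04 F N t U) p : (MatA N)ˣ) : MatA N).det := by
  haveI : Nonempty (Fin N) := ⟨⟨0, Nat.pos_of_ne_zero (NeZero.ne N)⟩⟩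
  have hL : 1 ≤ F.L := le_of_lt F.hL.2
  rw [det_fhol_step04_eq_one F N t U p]
  exact det_fhol_step42_eq_one (d := 4) hL hU hα (by simpa using hsmall) (by simpa using hrank) hsf p

/-- The coarse-plaquette form (side `M`), as part 35 §3 consumes it. [folklore] -/
theorem det_cplaq_step42_eq_det_cplaq_step04 (t M : ℕ) {U : (Fin 4 → ℤ) → Fin 4 → (MatA N)ˣ} (hU : ∀ x κ, U x κ ∈ specialUnitaryUnits (Fin N))
    {α : ℝ} (hα : 0 ≤ α) (hsmall : 512 * (4 + 1) * (4 + 4) * (F.L : ℝ) ^ 2 * α ≤ 1)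
    (hrank : Fintype.card (Fin N) * (16 * ((4 : ℝ) + 1) * (4 + 4) * (F.L : ℝ) ^ 2 * α) < Real.pi) (hsf : SmallField U α) (z : Fin 4 → ℤ) (μ ν : Fin 4) :
    ((cplaq M (step42 F.L U) z μ ν : (MatA N)ˣ) : MatA N).det = ((cplaq M (step04 F N t U) z μ ν : (MatA N)ˣ) : MatA N).det := by
  haveI : Nonempty (Fin N) := ⟨⟨0, Nat.pos_of_ne_zero (NeZero.ne N)⟩⟩
  have hL : 1 ≤ F.L := le_of_lt F.hL.2
  rw [det_cplaq_step04_eq_one F N t M U z μ ν]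
  exact det_cplaq_step42_eq_one (d := 4) hL hU hα (by simpa using hsmall) (by simpa using hrank) hsf M z μ ν

end Record

end

end Summit.QuantumFields.YangMills.BalabanUVNodes.N16CoarsePlaquetteDetOne
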